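import Summits.CriticalPhenomena.PercolationContinuityZ3.Theorems.PercNearOneGluingNoHeavyLowerTailKnQuestion8CoefficientwiseNCAOfNoCore
import Summits.CriticalPhenomena.PercolationContinuityZ3.Theorems.PercNearOneGluingNoHeavyLowerTailKnQuestion8CoefficientwiseForest
import HarnessLib

/-!
# NCA (hence NO-CORE, `(I1)_X`, `A₀₀`) holds on every forest, for every root and all target / avoided sets — prim-lf-2 gen 63

Support file (`--supports stmt-CriticalPhenomena-4575`, closed), prover `prim-lf-2` (gen 63).  No definitions, no named facts, no sorries; standard axioms.
Memo `prim-lf-2/CW-NCA-gen63.md` §7.  First unconditional infinite class for the whole NCA family, obtained from the gen-63 reductions: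
on a simple forest no vertex other than the root is joined to it in both colours (`eq_root_of_mem_openCluster_both`, gen 26), so NO-CORE for any target SET is the full
two-colouring Harris sum (`harris_twoColouring_powerset`); sub-edge-sets of a forest are forests, so `nca_of_multiTargetNoCore` (iterated X-elimination) gives every NCA sum.
* `Coefficientwise.ncStar_of_forest` — `0 ≤ Σ_{s ⊆ E : ∀ w∈W, ¬(w ∈ C_x s ∧ w ∈ C_x(E∖s))} T` for a simple forest `E`, every `W`.
* `Coefficientwise.nca_of_forest` — `0 ≤ NCA_E(x; X, W)` for a simple forest `E`, every root `x`, all `X, W`, all monotone `f, g`.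
[cite: KozmaNitzan2024, Questions 8–9 (§5.5 p. 36) (context: the Question-8 pocket covariance programme)]
-/

namespace Summit.CriticalPhenomena.PercolationContinuityZ3.Theorems

open Finset Literature.Probability.Percolation

namespace Coefficientwise

variable {ι V : Type*} [Fintype ι] [DecidableEq ι]

open Classical in
/-- **NO-CORE for target sets on a forest.**  If the edges of `E` are pairwise distinct as unordered pairs and span an acyclic simple graph, then for every vertex set `W` and all
monotone `φ, ψ`: `0 ≤ Σ_{s ⊆ E : ∀ w ∈ W, ¬(w ∈ C_x s ∧ w ∈ C_x(E∖s))} (φ(C_x s) − φ(C_x(E∖s)))(ψ(C_x s) − ψ(C_x(E∖s)))`.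
[cite: KozmaNitzan2024, Questions 8–9 (§5.5 p. 36) (context)] -/
theorem ncStar_of_forest (ends : ι → Sym2 V) {E : Finset ι} (x : V)
    (hinj : ∀ i ∈ E, ∀ j ∈ E, ends i = ends j → i = j) (hacyc : (openGraph (ends '' (↑E : Set ι))).IsAcyclic)
    (W : Set V) (φ ψ : Set V → ℝ) (hφ : Monotone φ) (hψ : Monotone ψ) :
    0 ≤ ∑ s ∈ E.powerset.filter (fun s : Finset ι =>
          ∀ w ∈ W, ¬ (w ∈ openCluster (ends '' (↑s : Set ι)) x ∧ w ∈ openCluster (ends '' (↑(E \ s) : Set ι)) x)),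
      (φ (openCluster (ends '' (↑s : Set ι)) x) - φ (openCluster (ends '' (↑(E \ s) : Set ι)) x)) *
        (ψ (openCluster (ends '' (↑s : Set ι)) x) - ψ (openCluster (ends '' (↑(E \ s) : Set ι)) x)) := by
  by_cases hxW : x ∈ W
  · -- the root is always in both clusters: the event is empty
    rw [Finset.sum_filter]
    refine Finset.sum_nonneg fun s _ => ?_
    rw [if_neg (fun h => h x hxW ⟨mem_openCluster_self _ x, mem_openCluster_self _ x⟩)]
  · -- no other vertex is ever in both clusters: the event is everything, and the full sum is the Harris two-colouring sum
    have hall : ∀ s ∈ E.powerset, ∀ w ∈ W, ¬ (w ∈ openCluster (ends '' (↑s : Set ι)) x ∧ w ∈ openCluster (ends '' (↑(E \ s) : Set ι)) x) := by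
      intro s hs w hw h
      have hwx : w = x := eq_root_of_mem_openCluster_both ends (Finset.mem_powerset.mp hs) hinj hacyc h.1 (by convert h.2)
      exact hxW (hwx ▸ hw)
    rw [Finset.filter_true_of_mem hall]
    exact harris_twoColouring_powerset E (fun t => φ (openCluster (ends '' (↑t : Set ι)) x)) (fun t => ψ (openCluster (ends '' (↑t : Set ι)) x))
      (fun a b hab => hφ (openCluster_image_mono ends hab x)) (fun a b hab => hψ (openCluster_image_mono ends hab x))

open Classical in
/-- **NCA on forests.**  If the edges of `E` are pairwise distinct as unordered pairs and span an acyclic simple graph, then for every root `x`, all vertex sets `X, W` and all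
monotone `f, g`: `0 ≤ NCA_E(x; X, W)`; in particular NO-CORE, the two-sided avoidance sums `(I1)_X` and the atom `A₀₀` are nonnegative on every forest.
[cite: KozmaNitzan2024, Questions 8–9 (§5.5 p. 36) (context)] -/
theorem nca_of_forest (ends : ι → Sym2 V) {E : Finset ι} (x : V)
    (hinj : ∀ i ∈ E, ∀ j ∈ E, ends i = ends j → i = j) (hacyc : (openGraph (ends '' (↑E : Set ι))).IsAcyclic)
    (X W : Set V) (f g : Set V → ℝ) (hf : Monotone f) (hg : Monotone g) :
    0 ≤ ∑ s ∈ E.powerset.filter (fun s : Finset ι =>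
          (∀ v ∈ X, v ∉ openCluster (ends '' (↑s : Set ι)) x ∧ v ∉ openCluster (ends '' (↑(E \ s) : Set ι)) x) ∧
          (∀ w ∈ W, ¬ (w ∈ openCluster (ends '' (↑s : Set ι)) x ∧ w ∈ openCluster (ends '' (↑(E \ s) : Set ι)) x))),
      (f (openCluster (ends '' (↑s : Set ι)) x) - f (openCluster (ends '' (↑(E \ s) : Set ι)) x)) *
        (g (openCluster (ends '' (↑s : Set ι)) x) - g (openCluster (ends '' (↑(E \ s) : Set ι)) x)) := by
  refine nca_of_multiTargetNoCore ends x E.card E le_rfl (fun E'' hE'' W' φ ψ hφ hψ => ?_) X W f g hf hg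
  have hle : openGraph (ends '' (↑E'' : Set ι)) ≤ openGraph (ends '' (↑E : Set ι)) := fun a b hab => openGraph_image_adj_mono ends hE'' hab
  exact ncStar_of_forest ends x (fun i hi j hj h => hinj i (hE'' hi) j (hE'' hj) h) (hacyc.anti hle) W' φ ψ hφ hψ

end Coefficientwise

end Summit.CriticalPhenomena.PercolationContinuityZ3.Theorems
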